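import Literature.Analysis.Complex.BochnerArgRegion
import HarnessLib

/-!
# The sharp maximum principle on argument regions (OS II (6.15))

Analysis/Complex support file (everything proved; no definitions, no named facts), sequel of
`BochnerArgRegion`. Osterwalder–Schrader II (Comm. Math. Phys. 42 (1975)), Ch. VI, (6.15) and its
use in §VI.2, p. 303: *"As `C_k^{(M+1)}` is just the envelope of holomorphy of the region
`⋃_{n+m-1=k} {…}` we can use the maximum principle (see (6.15) and e.g. Vladimirov p. 178), to
conclude that (6.28) holds for `N = M + 1`"* — a function holomorphic on the argument region of
the convex hull `conv B` and bounded by `M` on the argument region of `B` is bounded by `M` on the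
whole region of `conv B`:

* `norm_le_of_norm_le_on_argRegion` — for `B ⊆ (-π/2, π/2)ᵏ` open and star-shaped with respect
  to `0 ∈ B`, `f` holomorphic on `{Re ζᵢ > 0, (arg ζᵢ)ᵢ ∈ conv B}` and `‖f ζ‖ ≤ M` whenever
  `(arg ζᵢ)ᵢ ∈ B`: then `‖f ζ‖ ≤ M` whenever `(arg ζᵢ)ᵢ ∈ conv B`.

This is the tree's sharp maximum principle for tubes
(`exists_holomorphic_extension_tube_convexHull_of_bound`, `BochnerTubeFourier`) in the variables
`w = log ζ` of OS II (5.22), combined with the uniqueness of the extension.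

## References

* K. Osterwalder, R. Schrader, *Axioms for Euclidean Green's functions II*, Comm. Math. Phys. 42
  (1975) 281–305, Ch. VI (6.15), §VI.2 p. 303. [OsterwalderSchraderCMP1975]
* V. S. Vladimirov, *Methods of the Theory of Functions of Many Complex Variables* (1966), p. 178.
-/

noncomputable section

open _root_.Complex Set Filter Metric Real
open scoped _root_.Topology

namespace Literature.Analysis.Complex

open TubeFourier

variable {k : ℕ}

/-- **The sharp maximum principle on argument regions** (OS II (6.15) as used in §VI.2): if `f`
is holomorphic on `{Re ζᵢ > 0, (arg ζᵢ)ᵢ ∈ conv B}` and `‖f ζ‖ ≤ M` on `{(arg ζᵢ)ᵢ ∈ B}`, then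
`‖f ζ‖ ≤ M` on `{(arg ζᵢ)ᵢ ∈ conv B}` (`B ⊆ (-π/2, π/2)ᵏ` open, star-shaped with respect to
`0 ∈ B`). [cite: OsterwalderSchraderCMP1975, Ch. VI (6.15) and §VI.2 p. 303] -/
theorem norm_le_of_norm_le_on_argRegion {B : Set (Fin k → ℝ)} (hBo : IsOpen B)
    (h0 : (0 : Fin k → ℝ) ∈ B) (hst : StarConvex ℝ 0 B) (hB : B ⊆ {v | ∀ i, |v i| < π / 2})
    {f : (Fin k → ℂ) → ℂ}
    (hf : DifferentiableOn ℂ f {ζ | (∀ i, 0 < (ζ i).re) ∧ (fun i => (ζ i).arg) ∈ convexHull ℝ B})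
    {M : ℝ} (hM : ∀ ζ : Fin k → ℂ, (∀ i, 0 < (ζ i).re) → (fun i => (ζ i).arg) ∈ B → ‖f ζ‖ ≤ M)
    {ζ : Fin k → ℂ} (hζ : ∀ i, 0 < (ζ i).re) (hζB : (fun i => (ζ i).arg) ∈ convexHull ℝ B) :
    ‖f ζ‖ ≤ M := by
  classical
  have hcubec : Convex ℝ {v : Fin k → ℝ | ∀ i, |v i| < π / 2} := convex_setOf_forall_abs_lt _
  have hHB : convexHull ℝ B ⊆ {v : Fin k → ℝ | ∀ i, |v i| < π / 2} := convexHull_min hB hcubec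
  have hBsubH : B ⊆ convexHull ℝ B := subset_convexHull ℝ B
  -- Euclidean coordinates
  set e : EuclideanSpace ℝ (Fin k) ≃L[ℝ] (Fin k → ℝ) := EuclideanSpace.equiv (Fin k) ℝ with he
  have he_apply : ∀ (y : EuclideanSpace ℝ (Fin k)) (j : Fin k), e y j = y j := fun y j => rfl
  set B' : Set (EuclideanSpace ℝ (Fin k)) := e ⁻¹' B with hB'
  have hB'o : IsOpen B' := hBo.preimage e.continuous
  have h0' : (0 : EuclideanSpace ℝ (Fin k)) ∈ B' := by
    show e 0 ∈ B; rw [map_zero]; exact h0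
  have hst' : StarConvex ℝ (0 : EuclideanSpace ℝ (Fin k)) B' := by
    have := StarConvex.linear_preimage (s := B) (e : EuclideanSpace ℝ (Fin k) →ₗ[ℝ] (Fin k → ℝ))
      (by rw [show ((e : EuclideanSpace ℝ (Fin k) →ₗ[ℝ] (Fin k → ℝ)) 0) = 0 from map_zero _]; exact hst)
    exact this
  have hconv : convexHull ℝ B' = e ⁻¹' convexHull ℝ B := by
    rw [hB', ← ContinuousLinearEquiv.image_symm_eq_preimage,
      ← ContinuousLinearEquiv.image_symm_eq_preimage]
    exact (LinearMap.image_convexHull (e.symm : (Fin k → ℝ) →ₗ[ℝ] EuclideanSpace ℝ (Fin k)) B).symm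
  have hmem_tube : ∀ (S : Set (Fin k → ℝ)) (w : Fin k → ℂ),
      w ∈ tube (e ⁻¹' S) ↔ (fun j => (w j).im) ∈ S := by
    intro S w
    rw [mem_tube, Set.mem_preimage]
    exact Iff.of_eq (congrArg (· ∈ S) (funext fun j => by rw [he_apply, imv_apply]))
  -- exp
  have hexp : ∀ w : Fin k → ℂ, (fun j => (w j).im) ∈ convexHull ℝ B →
      (∀ j, 0 < (Complex.exp (w j)).re) ∧ (fun j => (Complex.exp (w j)).arg) = fun j => (w j).im := by
    intro w hw
    have h := fun j => re_exp_pos_and_arg_exp (hHB hw j)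
    exact ⟨fun j => (h j).1, funext fun j => (h j).2⟩
  have hexp_d : Differentiable ℂ fun w : Fin k → ℂ => (fun j => Complex.exp (w j)) :=
    differentiable_pi.2 fun j => Complex.differentiable_exp.comp (differentiable_apply (𝕜 := ℂ) j)
  -- the function in tube coordinates, on the tube over the hull and on the tube over `B`
  set g : (Fin k → ℂ) → ℂ := fun w => f fun j => Complex.exp (w j) with hg
  have hgdH : DifferentiableOn ℂ g (tube (convexHull ℝ B')) := by
    refine hf.comp hexp_d.differentiableOn fun w hw => ?_
    rw [hconv, hmem_tube] at hw
    obtain ⟨hre, harg⟩ := hexp w hw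
    exact ⟨hre, by rw [harg]; exact hw⟩
  have hgdB : DifferentiableOn ℂ g (tube B') :=
    hgdH.mono (tube_mono (by rw [hconv]; exact preimage_mono hBsubH))
  have hgM : ∀ w ∈ tube B', ‖g w‖ ≤ M := by
    intro w hw
    have hw' : (fun j => (w j).im) ∈ B := (hmem_tube B w).1 hw
    obtain ⟨hre, harg⟩ := hexp w (hBsubH hw')
    exact hM _ hre (by rw [harg]; exact hw')
  -- the sharp maximum principle on tubes, and uniqueness
  obtain ⟨Gext, hGext_d, hGext_eq, hGext_bd, hGext_uniq⟩ :=
    exists_holomorphic_extension_tube_convexHull_of_bound hB'o h0' hst' hgdB hgM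
  have hgG : EqOn g Gext (tube (convexHull ℝ B')) := hGext_uniq g hgdH fun _ _ => rfl
  -- evaluate at `w = log ζ`
  set w : Fin k → ℂ := fun j => Complex.log (ζ j) with hw
  have hζ0 : ∀ j, ζ j ≠ 0 := fun j h => by have := hζ j; rw [h] at this; simp at this
  have hwmem : w ∈ tube (convexHull ℝ B') := by
    rw [hconv, hmem_tube]
    have : (fun j => (w j).im) = fun j => (ζ j).arg := funext fun j => Complex.log_im _
    rw [this]; exact hζB
  have hfw : f ζ = g w := by
    rw [hg]
    simp only [hw]
    congr 1
    exact (funext fun j => Complex.exp_log (hζ0 j)).symm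
  rw [hfw, hgG hwmem]
  exact hGext_bd w hwmem

end Literature.Analysis.Complex
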